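import Summits.QuantumFields.YangMills.Theorems.BalabanLadderROTWardShapeDeriv
import HarnessLib

/-!
# Crux `ROT` (stmt-QuantumFields-20042), infinitesimal Ward route (lane B) — VII: the SHAPE BARRIER for «direct estimates from the binder»

Helper file (`--supports stmt-QuantumFields-20042`, lane `ym-rot-20042-p2`).  The lane's strategy sentence (director-ym R281) proposed to
bound the rotation defect on King's class by `C·a_k²|log a_k|^p ×` (the `MomentBounds6` norms), «direct estimate from the binder».  After
summation by parts (`…WardEquiv.lean`) the defect is the angular insertion `Σ_x (𝓛W_k)(x) F(a_k x)`, and the binder bounds its SIZE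
(`norm_angularSum_eventually_le`: `O(1)`).  THIS FILE shows, kernel-checked, that the binder's numerical content cannot give more:

* §1 the WITNESS — unit map `a(β) = (max β 0 + 24)⁻¹` and the weight family `W β L 2 (x₀,x₁) = a⁸ h(a(x₀ − x₁))` (all other `n`
  zero, so the one-point weight vanishes as for centred moments; translation invariant; `|W| ≤ 2a⁸`, i.e. exact hyperscaling `a⁴` per
  point) satisfies EVERY inequality of `MomentBoundsShape` with `C = 2` (`momentBoundsShape_WW`: at a torus-separated pair the
  separation forces `R a < 1`);
* §2 along `β_k = k`, `L_k = (k+24)²` (ranges `a_k ≤ 1/24`, `14 ≤ L_k`, `a_k⁻² ≤ L_k` hold) the angular insertion of the witness at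
  the germ-class test function `F_s` converges to `−∫Φ_s ≠ 0` (`tendsto_angularSum_WW`: the lane's own exact summation by parts
  `sum_mul_latGen_eq_neg_angularSum`, the `O(a_k)` Taylor comparison `norm_latGen_sub_rotDeriv_le` + Riemann count, and the tree's
  `tendsto_riemann_sum` in `(ℝ⁴)²`);
* §3 **`exists_momentBoundsShape_not_angularWardShape`**: `MomentBoundsShape a W ∧ ¬ AngularWardShape a W` for this `(a, W)`.

READING (numbers, not adjectives): since `MomentBounds G r a ⇒ MomentBoundsShape a W_YM` and `LatticeAngularWard G r a ⇒
AngularWardShape a W_YM` (part VI), any derivation «binder inequalities ⊢ defect ≤ ω(a_k)·norms, ω → 0» would prove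
`MomentBoundsShape a W → AngularWardShape a W` for ALL weight families, which this file refutes.  A proof of the registered stub
(`KingLimit ⟺ KingAngular`) must therefore use properties of the Wilson measure beyond `MomentBounds6` (the dynamics: Schwinger–Dyson /
lattice energy–momentum insertions, non-perturbatively uncontrolled).  HONEST FRAMING: a barrier for one proof strategy of an OPEN
crux; it says nothing about the truth of `ROT`, E1, or the mass gap.  No fact, no sorry.
-/

set_option autoImplicit false

noncomputable section

open scoped SchwartzMap BigOperators RealInnerProductSpace ContDiff
open MeasureTheory Filter Topology Metric
open Literature.MathematicalPhysics.QuantumFieldTheory Literature.MathematicalPhysics.QuantumLattice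
open Literature.MathematicalPhysics.AQFT
open Literature.Probability.LatticeModels (box Site mem_box)
open Summit.QuantumFields.YangMills.Cruxes.OSLegsFromFemtoAndGap.DlrCollarTransfer (MomentBounds)
open Summit.QuantumFields.YangMills.Cruxes.OSLegsAtWeakCouplingC.Sketch (Separated SmallDiam)
open Summit.QuantumFields.YangMills.Cruxes.OSLegsAtWeakCouplingC.Y2Bridge (LatticeRotWard)
open Summit.QuantumFields.YangMills.Cruxes.OSLegsAtWeakCouplingC.Y2Bridge.King (KingClass)
open Summit.QuantumFields.YangMills.Theorems.OSLegsFromFemtoAndGap (torusMoment mul_norm_le_norm_smul_siteToE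
  norm_smul_siteToE_sub_le abs_coord_le_norm_siteToE siteToE_sub)
open Summit.QuantumFields.YangMills.Theorems.NPointIsotropy.Negative (E4)

namespace Summit.QuantumFields.YangMills.Theorems.ROT.Ward

/-! ## §1 The witness family and its shape bound -/

/-- The witness unit map `a(β) = (max β 0 + 24)⁻¹`. -/
def aW (β : ℝ) : ℝ := (max β 0 + 24)⁻¹

/-- `a(β) > 0`. -/
theorem aW_pos (β : ℝ) : 0 < aW β := by unfold aW; positivity

/-- `a(β) ≤ 1/24`. -/
theorem aW_le (β : ℝ) : aW β ≤ 1 / 24 := by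
  unfold aW
  rw [inv_le_comm₀ (by positivity) (by norm_num)]
  have := le_max_right β 0
  linarith

/-- `a(β) → 0`. -/
theorem tendsto_aW : Tendsto aW atTop (𝓝 0) := by
  refine tendsto_inv_atTop_zero.comp ?_
  refine tendsto_atTop_mono (fun β => ?_) tendsto_id
  simp only [id]
  linarith [le_max_left β 0]

/-- **The witness weights**: `W β L 2 x = a(β)⁸ h(a(β)(x₀ − x₁))`, all other `n` zero (in particular the one-point weight
vanishes: centred).  Translation invariant; pointwise `|W| ≤ 2 a⁸` (exact hyperscaling `a⁴` per point). -/
def WW (β : ℝ) (_L : ℕ) (n : ℕ) (x : Fin n → Site 4) : ℝ :=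
  if h : n = 2 then aW β ^ 8 * hFun (scaleSite (aW β) x ⟨0, by omega⟩ - scaleSite (aW β) x ⟨1, by omega⟩) else 0

/-- The two-point witness weight. -/
theorem WW_two (β : ℝ) (L : ℕ) (x : Fin 2 → Site 4) :
    WW β L 2 x = aW β ^ 8 * hFun (scaleSite (aW β) x 0 - scaleSite (aW β) x 1) := by
  simp only [WW, dif_pos]
  rfl

/-- All other weights vanish. -/
theorem WW_of_ne_two (β : ℝ) (L : ℕ) {n : ℕ} (hn : n ≠ 2) (x : Fin n → Site 4) : WW β L n x = 0 := by
  simp [WW, hn]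

/-- Pointwise hyperscaling of the witness: `|W β L n x| ≤ 2 a(β)⁸` (and `= 0` unless `n = 2`). -/
theorem abs_WW_le (β : ℝ) (L : ℕ) {n : ℕ} (x : Fin n → Site 4) : |WW β L n x| ≤ 2 * aW β ^ 8 := by
  by_cases hn : n = 2
  · subst hn
    rw [WW_two, abs_mul, abs_of_nonneg (by positivity : 0 ≤ aW β ^ 8)]
    nlinarith [abs_hFun_le (scaleSite (aW β) x 0 - scaleSite (aW β) x 1), pow_pos (aW_pos β) 8]
  · rw [WW_of_ne_two β L hn, abs_zero]; positivity

/-- Translation invariance of the witness weights. -/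
theorem WW_translate (β : ℝ) (L : ℕ) (x : Fin 2 → Site 4) (t : Site 4) :
    WW β L 2 (fun i => x i + t) = WW β L 2 x := by
  rw [WW_two, WW_two]
  congr 2
  ext ν
  simp only [scaleSite, PiLp.sub_apply, PiLp.smul_apply, siteToE_apply, Pi.add_apply, smul_eq_mul]
  push_cast
  ring

/-- **The witness obeys every MomentBounds-shape inequality** (constant `C = 2`, any `ℓ₄`, all `β`): at a torus-separated pair the
separation forces `R a < 1`, so `a⁸ |h| ≤ 2 a⁸ ≤ (2/R⁴)²`. -/
theorem momentBoundsShape_WW : MomentBoundsShape aW WW := by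
  refine ⟨2, 0, 1, one_pos, by norm_num, ?_⟩
  intro β _ L n x R hR1 _ _ hsep
  have hRpos : (0 : ℝ) < R := by exact_mod_cast hR1
  by_cases hn : n = 2
  · subst hn
    rw [WW_two]
    set a := aW β with ha_def
    have ha : 0 < a := aW_pos β
    set z : E4 := scaleSite a x 0 - scaleSite a x 1 with hz_def
    by_cases hz : hFun z = 0
    · rw [hz, mul_zero, abs_zero]; positivity
    have hz2 : ‖z‖ < 2 := by
      by_contra h
      exact hz (hFun_eq_zero_of_norm (not_lt.1 h))
    obtain ⟨k, hk⟩ := hsep 0 1 (by decide)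
    have h1 : |((((x 0 k - x 1 k : ℤ) : ZMod (2 * L + 1))).valMinAbs : ℤ)| ≤ |x 0 k - x 1 k| := by
      have h := ZMod.natAbs_min_of_le_div_two (2 * L + 1) _ (x 0 k - x 1 k) (ZMod.coe_valMinAbs _)
        (ZMod.natAbs_valMinAbs_le _)
      rw [Int.abs_eq_natAbs, Int.abs_eq_natAbs]
      exact_mod_cast h
    have h2 : ((|x 0 k - x 1 k| : ℤ) : ℝ) ≤ ‖siteToE (x 0 - x 1)‖ := by
      have := abs_coord_le_norm_siteToE (x 0 - x 1) k
      simpa using this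
    have h3 : ‖z‖ = a * ‖siteToE (x 0 - x 1)‖ := by
      have : z = a • siteToE (x 0 - x 1) := by
        rw [hz_def, siteToE_sub, smul_sub]; rfl
      rw [this, norm_smul, Real.norm_eq_abs, abs_of_pos ha]
    have h4 : (2 * (R : ℝ) + 4) ≤ ‖siteToE (x 0 - x 1)‖ := by
      have : ((2 * (R : ℤ) + 4 : ℤ) : ℝ) ≤ ((|x 0 k - x 1 k| : ℤ) : ℝ) := by exact_mod_cast hk.trans h1
      push_cast at this h2
      linarith
    have haR : a * R ≤ 1 := by nlinarith
    have haR8 : (a * R) ^ 8 ≤ 1 := pow_le_one₀ (by positivity) haR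
    rw [abs_mul, abs_of_nonneg (by positivity : 0 ≤ a ^ 8), div_pow, ← pow_mul,
      le_div_iff₀ (by positivity)]
    have hh := abs_hFun_le z
    calc a ^ 8 * |hFun z| * (R : ℝ) ^ (4 * 2) = (a * R) ^ 8 * |hFun z| := by ring
      _ ≤ 1 * 2 := mul_le_mul haR8 hh (abs_nonneg _) zero_le_one
      _ ≤ 2 ^ 2 := by norm_num
  · rw [WW_of_ne_two β L hn, abs_zero]; positivity

/-! ## §2 Along the witness schemes the angular insertion converges to `−∫Φ_s ≠ 0` -/

/-- The torus half-sides of the witness schemes: `L_k = (k+24)²` (so `a_k⁻² = L_k`, `a_k = (k+24)⁻¹`). -/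
def LW (k : ℕ) : ℕ := (k + 24) ^ 2

/-- `a_k = (k + 24)⁻¹` along `β_k = k`. -/
theorem aW_natCast (k : ℕ) : aW k = ((k : ℝ) + 24)⁻¹ := by
  simp [aW]

/-- `a_k L_k = k + 24`. -/
theorem aW_mul_LW (k : ℕ) : aW k * (LW k : ℝ) = (k : ℝ) + 24 := by
  rw [aW_natCast, LW]
  push_cast
  field_simp

/-- `a_k → 0`. -/
theorem tendsto_aW_nat : Tendsto (fun k : ℕ => aW k) atTop (𝓝 0) :=
  tendsto_aW.comp tendsto_natCast_atTop_atTop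

/-- `a_k L_k → ∞`. -/
theorem tendsto_aW_mul_LW : Tendsto (fun k : ℕ => aW k * (LW k : ℝ)) atTop atTop := by
  simp_rw [aW_mul_LW]
  exact tendsto_atTop_add_const_right _ _ tendsto_natCast_atTop_atTop

/-- The witness schemes satisfy the soft-bundle torus ranges. -/
theorem ranges_W (k : ℕ) :
    0 ≤ (k : ℝ) ∧ aW k ≤ 1 / 24 ∧ 14 ≤ LW k ∧ (aW k)⁻¹ * (aW k)⁻¹ ≤ (LW k : ℝ) := by
  refine ⟨Nat.cast_nonneg k, aW_le k, ?_, ?_⟩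
  · unfold LW
    exact le_trans (by norm_num) (Nat.pow_le_pow_left (by omega : 24 ≤ k + 24) 2)
  · rw [aW_natCast, inv_inv, LW]
    push_cast
    nlinarith

/-- **The angular insertion of the witness converges to `−∫ Φ_s`** along `(a_k, L_k) = ((k+24)⁻¹, (k+24)²)`: exact summation
by parts (`sum_mul_latGen_eq_neg_angularSum`), the `O(a_k)` Taylor comparison with the rotational derivative `D F_s`
(`norm_latGen_sub_rotDeriv_le`, Riemann count), and the Riemann sum `a_k⁸ Σ_x Φ_s(a_k x) → ∫ Φ_s` (`tendsto_riemann_sum`). -/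
theorem tendsto_angularSum_WW {s : ℝ} (hs : 0 < s) (hs1 : s ≤ 1) :
    Tendsto (fun k : ℕ => angularSum (WW k (LW k) 2) (LW k) (aW k) (FTest s hs hs1)) atTop
      (𝓝 (-(((∫ w, PhiFun s hs w : ℝ)) : ℂ))) := by
  classical
  obtain ⟨D, hD⟩ :=
    Summit.QuantumFields.YangMills.Cruxes.OSLegsAtWeakCouplingC.Sketch.GermWard.exists_schwartz_rotDeriv (FTest s hs hs1)
  have hFc : HasCompactSupport (FTest s hs hs1 : (Fin 2 → E4) → ℂ) := hasCompactSupport_fFun hs hs1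
  obtain ⟨K, hK0, hK⟩ := exists_lipschitz_fderiv (FTest s hs hs1) hFc
  obtain ⟨M, hM0, hM⟩ := eventually_card_scaled_le (n := 2) 4 (fun k : ℕ => aW k) LW (fun k => aW_pos _)
    tendsto_aW_nat tendsto_aW_mul_LW
  -- the support of `F_s` lies in the ball of radius `4`
  have hsupp4 : ∀ w, w ∈ tsupport (FTest s hs hs1 : (Fin 2 → E4) → ℂ) → ‖w‖ ≤ 4 := by
    intro w hw
    have hsub : tsupport (FTest s hs hs1 : (Fin 2 → E4) → ℂ) ⊆ closedBall 0 4 := by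
      refine closure_minimal (fun w hw => ?_) isClosed_closedBall
      rw [mem_closedBall, dist_zero_right]
      by_contra h
      exact hw (by rw [FTest_apply, fFun_eq_zero_of_norm hs1 (not_le.1 h), Complex.ofReal_zero])
    have := hsub hw
    rwa [mem_closedBall, dist_zero_right] at this
  -- (1) exact summation by parts at every `k`
  have hsbp : ∀ k : ℕ, angularSum (WW k (LW k) 2) (LW k) (aW k) (FTest s hs hs1) =
      -∑ x ∈ Fintype.piFinset (fun _ : Fin 2 => box 4 (LW k)),
        ((WW k (LW k) 2 x : ℝ) : ℂ) * latGen (aW k) (FTest s hs hs1) x := by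
    intro k
    have ha := aW_pos k
    have hΦ : ∀ x : Fin 2 → Site 4, FTest s hs hs1 (scaleSite (aW k) x) ≠ 0 → ∀ j ν, |x j ν| + 1 ≤ (LW k : ℤ) := by
      intro x hx j ν
      have hw : ‖scaleSite (aW k) x‖ ≤ 4 := hsupp4 _ (subset_tsupport _ (Function.mem_support.2 hx))
      have h1 : (‖x j ν‖ : ℝ) ≤ ‖x‖ := (norm_le_pi_norm (x j) ν).trans (norm_le_pi_norm x j)
      rw [Int.norm_eq_abs] at h1
      have h2 : aW k * |(x j ν : ℝ)| ≤ 4 :=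
        ((mul_le_mul_of_nonneg_left h1 ha.le).trans (mul_norm_le_norm_scaleSite ha.le x)).trans hw
      rw [aW_natCast] at h2
      have hk : (0 : ℝ) < (k : ℝ) + 24 := by positivity
      have h3 : |(x j ν : ℝ)| ≤ 4 * ((k : ℝ) + 24) := by
        have := mul_le_mul_of_nonneg_left h2 hk.le
        rw [← mul_assoc, mul_inv_cancel₀ hk.ne', one_mul] at this
        linarith
      have h4 : |(x j ν : ℝ)| + 1 ≤ ((LW k : ℕ) : ℝ) := by
        rw [LW]; push_cast; nlinarith
      have h5 : ((|x j ν| + 1 : ℤ) : ℝ) ≤ ((LW k : ℤ) : ℝ) := by push_cast; exact h4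
      exact_mod_cast h5
    have h := sum_mul_latGen_eq_neg_angularSum (LW k) (aW k) (WW k (LW k) 2) (FTest s hs hs1) hΦ
    rw [h, neg_neg]
  -- (2) the main term: a Riemann sum of `Φ_s`
  have hmain : Tendsto (fun k : ℕ => ∑ x ∈ Fintype.piFinset (fun _ : Fin 2 => box 4 (LW k)),
      ((WW k (LW k) 2 x : ℝ) : ℂ) * D (scaleSite (aW k) x)) atTop (𝓝 (((∫ w, PhiFun s hs w : ℝ)) : ℂ)) := by
    have hR := Summit.QuantumFields.YangMills.Cruxes.OSLegsAtWeakCouplingC.Sketch.tendsto_riemann_sum (PhiFun s hs)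
      (continuous_PhiFun s hs) (hasCompactSupport_PhiFun s hs hs1) (fun k : ℕ => aW k) LW (fun k => aW_pos _)
      tendsto_aW_nat tendsto_aW_mul_LW
    have hR2 : Tendsto (fun k : ℕ => aW k ^ (4 * 2) *
        ∑ x ∈ Fintype.piFinset (fun _ : Fin 2 => box 4 (LW k)), PhiFun s hs (scaleSite (aW k) x)) atTop
        (𝓝 (∫ w, PhiFun s hs w)) := hR
    have hR' := (Complex.continuous_ofReal.tendsto _).comp hR2
    refine hR'.congr' (Eventually.of_forall fun k => ?_)
    have hterm : ∀ x : Fin 2 → Site 4, ((WW k (LW k) 2 x : ℝ) : ℂ) * D (scaleSite (aW k) x) =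
        (((aW k) ^ 8 * PhiFun s hs (scaleSite (aW k) x) : ℝ) : ℂ) := by
      intro x
      rw [WW_two, hD, rotField_eq_rotVec, fderiv_FTest_rotField s hs hs1]
      simp only [PhiFun]
      push_cast
      ring
    simp only [Function.comp_apply]
    rw [Finset.sum_congr rfl fun x _ => hterm x]
    push_cast
    rw [Finset.mul_sum]
  -- (3) the Taylor remainder is `O(a_k)`
  have hrem : Tendsto (fun k : ℕ => ∑ x ∈ Fintype.piFinset (fun _ : Fin 2 => box 4 (LW k)),
      ((WW k (LW k) 2 x : ℝ) : ℂ) * (latGen (aW k) (FTest s hs hs1) x - D (scaleSite (aW k) x))) atTop (𝓝 0) := by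
    have hev : ∀ᶠ k : ℕ in atTop, ‖∑ x ∈ Fintype.piFinset (fun _ : Fin 2 => box 4 (LW k)),
        ((WW k (LW k) 2 x : ℝ) : ℂ) * (latGen (aW k) (FTest s hs hs1) x - D (scaleSite (aW k) x))‖ ≤
        (2 * (20 * K) * M) * aW k := by
      filter_upwards [hM] with k hkM
      have ha := aW_pos k
      have ha1 : aW k ≤ 1 := (aW_le k).trans (by norm_num)
      set a := aW k with ha_def
      set S := Fintype.piFinset (fun _ : Fin 2 => box 4 (LW k)) with hS
      have hpt : ∀ x ∈ S, ‖((WW k (LW k) 2 x : ℝ) : ℂ) * (latGen a (FTest s hs hs1) x - D (scaleSite a x))‖ ≤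
          2 * a ^ 8 * (20 * K * a) * (if ‖scaleSite a x‖ ≤ 4 + 1 then 1 else 0) := by
        intro x _
        by_cases hne : latGen a (FTest s hs hs1) x - D (scaleSite a x) = 0
        · rw [hne, mul_zero, norm_zero]
          split_ifs <;> positivity
        have hxρ : ‖scaleSite a x‖ ≤ 4 + a := by
          rcases exists_mem_tsupport_of_latGen_sub_rotDeriv_ne_zero (FTest s hs hs1) D hD a x hne with h0 | ⟨i, μ, hiμ⟩
          · linarith [hsupp4 _ h0]
          · have h1 := hsupp4 _ hiμ
            have h2 : ‖(a • contUnitVec i μ : Fin 2 → E4)‖ = a := by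
              rw [norm_smul, norm_contUnitVec, mul_one, Real.norm_eq_abs, abs_of_pos ha]
            calc ‖scaleSite a x‖ = ‖(scaleSite a x + a • contUnitVec i μ) - a • contUnitVec i μ‖ := by
                  rw [add_sub_cancel_right]
              _ ≤ ‖scaleSite a x + a • contUnitVec i μ‖ + ‖(a • contUnitVec i μ : Fin 2 → E4)‖ := norm_sub_le _ _
              _ ≤ 4 + a := by rw [h2]; exact add_le_add h1 le_rfl
        have hx5 : ‖scaleSite a x‖ ≤ 5 := by linarith
        have h45 : ‖scaleSite a x‖ ≤ 4 + 1 := by linarith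
        rw [if_pos h45, mul_one, norm_mul, Complex.norm_real, Real.norm_eq_abs]
        have hWx : |WW k (LW k) 2 x| ≤ 2 * a ^ 8 := abs_WW_le _ _ _
        have hr : ‖latGen a (FTest s hs hs1) x - D (scaleSite a x)‖ ≤ 20 * K * a := by
          refine (norm_latGen_sub_rotDeriv_le (FTest s hs hs1) D hD hK0 hK a x).trans ?_
          have h1 : a * ‖x‖ ≤ 5 := (mul_norm_le_norm_scaleSite ha.le x).trans hx5
          have h3 : (2 : ℝ) * (2 : ℕ) * K * a ^ 2 * ‖x‖ = 4 * K * a * (a * ‖x‖) := by push_cast; ring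
          rw [h3]
          have h2 : 0 ≤ 4 * K * a := by positivity
          nlinarith [mul_le_mul_of_nonneg_left h1 h2]
        exact mul_le_mul hWx hr (norm_nonneg _) (by positivity)
      have hkM' : a ^ 8 * ((S.filter (fun x => ‖scaleSite a x‖ ≤ 4 + 1)).card : ℝ) ≤ M := by
        have : a ^ (4 * 2) = a ^ 8 := by norm_num
        rw [← this]; exact hkM
      calc _ ≤ ∑ x ∈ S, 2 * a ^ 8 * (20 * K * a) * (if ‖scaleSite a x‖ ≤ 4 + 1 then 1 else 0) :=
            (norm_sum_le _ _).trans (Finset.sum_le_sum hpt)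
        _ = 2 * (20 * K) * a * (a ^ 8 * ((S.filter (fun x => ‖scaleSite a x‖ ≤ 4 + 1)).card : ℝ)) := by
            rw [← Finset.mul_sum, Finset.sum_boole]; ring
        _ ≤ 2 * (20 * K) * a * M := by gcongr
        _ = (2 * (20 * K) * M) * a := by ring
    refine squeeze_zero_norm' hev ?_
    simpa using tendsto_aW_nat.const_mul (2 * (20 * K) * M)
  -- (4) assemble
  have hsum : ∀ k : ℕ, ∑ x ∈ Fintype.piFinset (fun _ : Fin 2 => box 4 (LW k)),
        ((WW k (LW k) 2 x : ℝ) : ℂ) * latGen (aW k) (FTest s hs hs1) x =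
      ∑ x ∈ Fintype.piFinset (fun _ : Fin 2 => box 4 (LW k)), ((WW k (LW k) 2 x : ℝ) : ℂ) * D (scaleSite (aW k) x) +
      ∑ x ∈ Fintype.piFinset (fun _ : Fin 2 => box 4 (LW k)),
        ((WW k (LW k) 2 x : ℝ) : ℂ) * (latGen (aW k) (FTest s hs hs1) x - D (scaleSite (aW k) x)) := by
    intro k
    rw [← Finset.sum_add_distrib]
    refine Finset.sum_congr rfl fun x _ => ?_
    ring
  have hlim := (hmain.add hrem).neg
  rw [add_zero] at hlim
  refine hlim.congr (fun k => ?_)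
  rw [hsbp k, hsum k]

/-! ## §3 The shape barrier -/

/-- **The witness violates the AngularWard shape**: along `β_k = k`, `L_k = (k+24)²` and for every germ radius `r₀`, the test
function `F_s` (`s = min (r₀/4) 1`) of King's class has angular insertion `→ −∫Φ_s ≠ 0`. -/
theorem not_angularWardShape_WW : ¬ AngularWardShape aW WW := by
  intro h
  obtain ⟨r₀, hr₀, H⟩ := h (fun k => (k : ℝ)) LW tendsto_natCast_atTop_atTop ranges_W
  set s : ℝ := min (r₀ / 4) 1 with hs_def
  have hs : 0 < s := lt_min (by positivity) one_pos
  have hs1 : s ≤ 1 := min_le_right _ _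
  have h2s : 2 * s < r₀ := by
    have := min_le_left (r₀ / 4) 1
    linarith
  obtain ⟨hFo, hFc, hFδ, hFr⟩ := FTest_mem_kingClass s hs hs1 h2s
  have h0 := H 2 le_rfl (FTest s hs hs1) hFo hFc hFδ hFr
  have h1 := tendsto_angularSum_WW hs hs1
  have heq := tendsto_nhds_unique h0 h1
  have hpos := integral_PhiFun_pos s hs hs1
  have : ((∫ w, PhiFun s hs w : ℝ) : ℂ) = 0 := by
    have := congrArg Neg.neg heq
    simpa using this.symm
  exact hpos.ne' (by exact_mod_cast this)

/-- **SHAPE BARRIER for the «direct estimate from the binder».**  There is a unit map `a` (`0 < a → 0`) and a weight family `W`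
— only the two-point weight non-zero (the one-point weight vanishes, as for centred moments), translation invariant, of exact
hyperscaling size `|W| ≤ 2 a⁸` — that satisfies EVERY inequality of the MomentBounds shape (`C = 2`) and yet violates the
AngularWard shape: its angular insertion converges to a non-zero number on King's class at every germ radius.  Consequently no
estimate of the form «angular defect ≤ ω(a_k) × (MomentBounds norms)», `ω → 0`, can be derived from the binder's inequalities alone:
a proof of `KingAngular` (equivalently `KingLimit`, `stub_kingLimit`) must use the Yang–Mills dynamics beyond `MomentBounds6`. -/
theorem exists_momentBoundsShape_not_angularWardShape :
    ∃ (a : ℝ → ℝ) (W : ℝ → ℕ → (n : ℕ) → (Fin n → Site 4) → ℝ),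
      (∀ β, 0 < a β) ∧ Tendsto a atTop (𝓝 0) ∧
      (∀ β L n (x : Fin n → Site 4), n ≠ 2 → W β L n x = 0) ∧
      (∀ β L (x : Fin 2 → Site 4) (t : Site 4), W β L 2 (fun i => x i + t) = W β L 2 x) ∧
      (∀ β L n (x : Fin n → Site 4), |W β L n x| ≤ 2 * a β ^ 8) ∧
      MomentBoundsShape a W ∧ ¬ AngularWardShape a W :=
  ⟨aW, WW, aW_pos, tendsto_aW, fun β L _ x hn => WW_of_ne_two β L hn x, WW_translate, fun β L _ x => abs_WW_le β L x,
    momentBoundsShape_WW, not_angularWardShape_WW⟩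

end Summit.QuantumFields.YangMills.Theorems.ROT.Ward

end
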